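import Summits.QuantumAdvantage.QuantumAdvantage.Theorems.AnchorDialWindow

/-!
# AnchorDial — part 16/16 «WindowDial» (cell decomp-qadv, seat lens-2, generation 14 rev 8; supports item 26531 `ExactnessDial.PolyLossOddU3`)

§12i of the node (rev 8), second half: the DICHOTOMY at window level.  **`windowDev_loss_needs_degree`** (degree is
necessary in the window law for every width `r ≥ 1`: part 13's anchor-`0` jitter witness), the classes `WAnchorable r c`
(`wAnchorable_mono`; width `0` = LEVEL 0 one degree step up: `wAnchorable_zero_of_uniDev_stabDev`, dominated by part 12's
degree-free `uniDev_loss_degfree`), the re-typed residual **`NoWindowAnchorLoss3`** (= `T` on strategies with no window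
anchor), `noWindowAnchorLoss3_of_polyLossOddU3`, **`polyLossOddU3_of_noWindowAnchorLoss3`** (dichotomy via part 15's
`windowDev_loss c c`), **`polyLossOddU3_iff_noWindowAnchorLoss3`**, **`closes_noWindowAnchor : NoWindowAnchorLoss3 → DPLift3 →
AdviceFreeQNC0Three`** (BY NAME via `HolonomyDial.closes_T`).  Verbatim from the node file (rev 8); namespace
`…Theorems.AnchorDial`; imports part 15; joint check `tree/Chain16.check.lean`; record NODE-g14.md §REV 8.  Prop defs
(`WAnchorable`, `NoWindowAnchorLoss3`) are statements of the node: `NoWindowAnchorLoss3` is the typed residual (≡ 26531), not a crux.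
-/

set_option linter.dupNamespace false
set_option linter.unusedVariables false

noncomputable section

open scoped Classical

namespace Summit.QuantumAdvantage.QuantumAdvantage.Theorems.AnchorDial

open Finset
open Literature.Computability.QuantumComplexity Literature.Computability.QuantumComplexity.RingHLF
open Literature.Computability.MetaComplexity Literature.Computability.MetaComplexity.Smolensky
open Summit.QuantumAdvantage.AdviceFreeQNC0
open Summit.QuantumAdvantage.QuantumAdvantage.Theses (ExactnessDial.PolyLossOddU3 ExactnessDial.DPLift3)
open Summit.QuantumAdvantage.QuantumAdvantage.Theorems.HolonomyDial (gCond tPoly tPoly_mem tPoly_apply selP selP_mem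
  selP_apply xorP xorP_mem xorP_apply_bool closes_T)

variable {N : ℕ}

section WindowDial

/-- **degree is necessary in `windowDev_loss` for EVERY width `r ≥ 1`** — the §12h witness again: the constant
anchor family `[k = 0]` (degree `0`, unique and flip-stable everywhere) with the unbounded-degree jitter strategy
«deviate at `0` if the walk condition holds there, else at `1`» has one deviation point in the window `[0, r]` on
every input and wins on every odd input: all exceptional sets of `windowDev_loss` and the losing set are EMPTY.
(At width `r = 0` there is nothing to select and the class is LEVEL 0: `wAnchorable_zero_of_uniDev_stabDev` +
`uniDev_loss_degfree`.) -/
theorem windowDev_loss_needs_degree (hN : 3 ≤ N) {r : ℕ} (hr : 1 ≤ r) :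
    ∃ P A : Fin N → CubeFn (ZMod 3) N,
      (∀ k, A k ∈ lowDeg (ZMod 3) N 0) ∧
      (univ.filter fun x : Fin N → Bool =>
          OddZeros x ∧ (univ.filter fun k : Fin N => A k x = 1).card ≠ 1) = ∅ ∧
      (∀ a : ℕ, (univ.filter fun x : Fin N → Bool =>
          OddZeros x ∧ ∃ k : Fin N, ¬ ((A k (flip2 a (a + 1) x) = 1) ↔ (A k x = 1))) = ∅) ∧
      (univ.filter fun x : Fin N → Bool => OddZeros x ∧ (dev P x).card ≠ 1) = ∅ ∧
      (univ.filter fun x : Fin N → Bool => OddZeros x ∧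
          ¬ ∃ k : Fin N, A k x = 1 ∧ ∀ i ∈ dev P x, k.val ≤ i.val ∧ i.val ≤ k.val + r) = ∅ ∧
      (univ.filter fun x : Fin N → Bool => OddZeros x ∧ ¬ Rel x (fun i => decide (P i x = 1))) = ∅ := by
  have hN0 : 0 < N := by omega
  have hanc : ∀ x : Fin N → Bool, (univ.filter fun k : Fin N => zeroAnchor k x = 1) = {⟨0, hN0⟩} := by
    intro x; ext k
    rw [mem_filter, mem_singleton, zeroAnchor_apply_eq_one, Fin.ext_iff]
    simp
  refine ⟨jitStrat, zeroAnchor, zeroAnchor_mem, ?_, ?_, ?_, ?_, ?_⟩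
  · refine filter_eq_empty_iff.2 fun x _ h => h.2 ?_
    rw [hanc x, card_singleton]
  · intro a
    refine filter_eq_empty_iff.2 fun x _ h => ?_
    obtain ⟨k, hk⟩ := h.2
    exact hk (by rw [zeroAnchor_apply_eq_one, zeroAnchor_apply_eq_one])
  · refine filter_eq_empty_iff.2 fun x _ h => h.2 ?_
    rw [dev_jitStrat (by omega) x, card_singleton]
  · refine filter_eq_empty_iff.2 fun x _ h =>
      h.2 ⟨⟨0, hN0⟩, (zeroAnchor_apply_eq_one _ _).2 rfl, fun i hi => ?_⟩
    rw [dev_jitStrat (by omega) x, mem_singleton] at hi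
    rw [hi]
    show 0 ≤ jitPtr x ∧ jitPtr x ≤ 0 + r
    have := jitPtr_le_one x
    omega
  · refine filter_eq_empty_iff.2 fun x _ h => h.2 ?_
    have hodd := h.1
    change Rel x (outB jitStrat x)
    rw [win_iff hN jitStrat x hodd, dev_jitStrat (by omega) x, filter_singleton]
    have hg : gCond x (jitPtr x) := by
      unfold jitPtr
      split_ifs with h0
      · exact h0
      · exact gCond_succ_of_not x hN0 h0
    rw [if_pos hg, card_singleton]

/-- WINDOW-ANCHORABLE at width `r`, degree budget `(log₂ N)^c`: the hypotheses of `windowDev_loss`. -/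
def WAnchorable (r c : ℕ) (P : Fin N → CubeFn (ZMod 3) N) : Prop :=
  ∃ A : Fin N → CubeFn (ZMod 3) N, (∀ k, A k ∈ lowDeg (ZMod 3) N ((Nat.log 2 N) ^ c)) ∧
    4096 * (univ.filter fun x : Fin N → Bool =>
        OddZeros x ∧ (univ.filter fun k : Fin N => A k x = 1).card ≠ 1).card ≤ 2 ^ (N - 1) ∧
    4096 * (∑ a ∈ range N, (univ.filter fun x : Fin N → Bool =>
        OddZeros x ∧ ∃ k : Fin N, ¬ ((A k (flip2 a (a + 1) x) = 1) ↔ (A k x = 1))).card) ≤ N * 2 ^ (N - 1) ∧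
    4096 * (univ.filter fun x : Fin N → Bool => OddZeros x ∧ (dev P x).card ≠ 1).card ≤ 2 ^ (N - 1) ∧
    4096 * (univ.filter fun x : Fin N → Bool => OddZeros x ∧
        ¬ ∃ k : Fin N, A k x = 1 ∧ ∀ i ∈ dev P x, k.val ≤ i.val ∧ i.val ≤ k.val + r).card ≤ 2 ^ (N - 1)

/-- the window classes grow with `r`. -/
theorem wAnchorable_mono {r r' c : ℕ} (hr : r ≤ r') {P : Fin N → CubeFn (ZMod 3) N} (h : WAnchorable r c P) :
    WAnchorable r' c P := by
  obtain ⟨A, hA, hU, hS, hD, hN⟩ := h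
  refine ⟨A, hA, hU, hS, hD, le_trans (Nat.mul_le_mul_left _ (card_le_card fun x hx => ?_)) hN⟩
  rw [mem_filter] at hx ⊢
  refine ⟨hx.1, hx.2.1, fun ⟨k, hk, hnear⟩ => hx.2.2 ⟨k, hk, fun i hi => ?_⟩⟩
  have h := hnear i hi
  omega

/-- the width-`0` window class IS the level-0 class one degree step up: `UniDev ∧ StabDev → WAnchorable 0 (c+1)`, the
strategy's own deviation indicators serving as anchors — so at `r = 0` the window law is dominated by the degree-free
`uniDev_loss_degfree`, while for every `r ≥ 1` degree is necessary (`windowDev_loss_needs_degree`): the JITTER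
LADDER `r = 0` (level 0) < `r ≥ 1` (polylog, essential), every rung discharged. -/
theorem wAnchorable_zero_of_uniDev_stabDev {c : ℕ} (hN : 64 ≤ N) {P : Fin N → CubeFn (ZMod 3) N}
    (hP : ∀ i, P i ∈ lowDeg (ZMod 3) N ((Nat.log 2 N) ^ c)) (hU : UniDev P) (hS : StabDev P) :
    WAnchorable 0 (c + 1) P := by
  have hbump := deg_bump4 N c hN
  refine ⟨devA P, fun k => lowDeg_mono (by omega) (devA_mem hP k), ?_, ?_, hU, ?_⟩
  · simp_rw [anc_devA]; exact hU
  · have e : ∀ a : ℕ, (univ.filter fun x : Fin N → Bool => OddZeros x ∧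
        ∃ k : Fin N, ¬ ((devA P k (flip2 a (a + 1) x) = 1) ↔ (devA P k x = 1))) =
        (univ.filter fun x : Fin N → Bool => OddZeros x ∧ dev P (flip2 a (a + 1) x) ≠ dev P x) := by
      intro a; ext x
      simp only [mem_filter, mem_univ, true_and, devA_apply_eq_one]
      rw [Ne, Finset.ext_iff, not_forall]
    simp_rw [e]; exact hS
  · refine le_trans (Nat.mul_le_mul_left 4096 (card_le_card fun x hx => ?_)) hU
    rw [mem_filter] at hx ⊢
    refine ⟨mem_univ _, hx.2.1, fun h1 => hx.2.2 ?_⟩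
    obtain ⟨p, hp⟩ := card_eq_one.1 h1
    refine ⟨p, ?_, fun i hi => ?_⟩
    · rw [devA_apply_eq_one, hp]; exact mem_singleton_self _
    · rw [hp, mem_singleton] at hi
      rw [hi]
      omega

/-- **PIECE (typed residual, rev 8) `NoWindowAnchorLoss3` — `T` RESTRICTED TO STRATEGIES WITH NO WINDOW ANCHOR**
(for the given width `r` and degree budget `c`): `≡ T` (`polyLossOddU3_iff_noWindowAnchorLoss3`); the excluded
classes `WAnchorable r c` (all `r`) are settled by `windowDev_loss`.  IDEA-NEEDED; BARRIER-ADJACENT. -/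
def NoWindowAnchorLoss3 : Prop :=
  ∃ C : ℕ, ∀ c r : ℕ, ∃ n₀ : ℕ, ∀ n ≥ n₀, ∀ P : Fin n → CubeFn (ZMod 3) n,
    (∀ i, P i ∈ lowDeg (ZMod 3) n ((Nat.log 2 n) ^ c)) → ¬ WAnchorable r c P →
      ((univ.filter fun x : Fin n → Bool => OddZeros x ∧ Rel x (fun i => decide (P i x = 1))).card : ℝ) ≤
        (1 - 1 / (n : ℝ) ^ C) * (2 : ℝ) ^ (n - 1)

/-- AnchorDialWindowDial helper `noWindowAnchorLoss3_of_polyLossOddU3` (decomp-qadv land package; see the module docstring). -/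
theorem noWindowAnchorLoss3_of_polyLossOddU3 (h : ExactnessDial.PolyLossOddU3) : NoWindowAnchorLoss3 := by
  obtain ⟨C, hC⟩ := h
  refine ⟨C, fun c _ => ?_⟩
  obtain ⟨n₀, hn₀⟩ := hC c
  exact ⟨n₀, fun n hn P hP _ => hn₀ n hn P hP⟩

/-- **dichotomy, rev 8: `NoWindowAnchorLoss3 → T`** — window-anchorable strategies (used at width `r = c`, any fixed
choice works) by `windowDev_loss`, the rest by the residual. -/
theorem polyLossOddU3_of_noWindowAnchorLoss3 (h : NoWindowAnchorLoss3) : ExactnessDial.PolyLossOddU3 := by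
  obtain ⟨C, hR⟩ := h
  refine ⟨max C 1, fun c => ?_⟩
  obtain ⟨n₁, hn₁⟩ := hR c c
  obtain ⟨n₂, hn₂⟩ := windowDev_loss c c
  refine ⟨max (max n₁ n₂) 49, fun n hn P hP => ?_⟩
  have hn1 : n₁ ≤ n := le_trans (le_trans (le_max_left _ _) (le_max_left _ _)) hn
  have hn2 : n₂ ≤ n := le_trans (le_trans (le_max_right _ _) (le_max_left _ _)) hn
  have hn49 : 49 ≤ n := le_trans (le_max_right _ _) hn
  have hP0 : (0 : ℝ) ≤ (2 : ℝ) ^ (n - 1) := by positivity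
  by_cases hc : WAnchorable c c P
  · obtain ⟨A, hA, hU, hS, hD, hN⟩ := hc
    have hL := hn₂ n hn2 P A hP hA hU hS hD hN
    have hWL := Finset.card_filter_add_card_filter_not
      (s := (univ : Finset (Fin n → Bool)).filter fun x => OddZeros x)
      (fun x => Rel x (fun i => decide (P i x = 1)))
    rw [filter_filter, filter_filter] at hWL
    have hO' := HolonomyDial.card_odd_le (n := n) (by omega)
    have h48 : 49 * (univ.filter fun x : Fin n → Bool =>
        OddZeros x ∧ Rel x (fun i => decide (P i x = 1))).card ≤ 48 * 2 ^ (n - 1) := by omega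
    have hfin : n * (univ.filter fun x : Fin n → Bool =>
        OddZeros x ∧ Rel x (fun i => decide (P i x = 1))).card + 2 ^ (n - 1) ≤ n * 2 ^ (n - 1) := by
      have h1 := Nat.mul_le_mul_left n h48
      rw [Nat.mul_left_comm n 49, Nat.mul_left_comm n 48] at h1
      have h2 := Nat.mul_le_mul_right (2 ^ (n - 1)) hn49
      omega
    have hreal := real_tail n _ (2 ^ (n - 1)) (by omega) hfin
    push_cast at hreal
    exact loss_shape_mono (by omega) (le_max_right C 1) _ _ hP0 hreal
  · exact loss_shape_mono (by omega) (le_max_left C 1) _ _ hP0 (hn₁ n hn1 P hP hc)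

/-- **NODE EQUATION, rev 8**: `T ⟺ NoWindowAnchorLoss3`. -/
theorem polyLossOddU3_iff_noWindowAnchorLoss3 : ExactnessDial.PolyLossOddU3 ↔ NoWindowAnchorLoss3 :=
  ⟨noWindowAnchorLoss3_of_polyLossOddU3, polyLossOddU3_of_noWindowAnchorLoss3⟩

/-- `closes` through the rev-8 residual. -/
theorem closes_noWindowAnchor (hR : NoWindowAnchorLoss3) (hD : ExactnessDial.DPLift3) : AdviceFreeQNC0Three :=
  closes_T (polyLossOddU3_of_noWindowAnchorLoss3 hR) hD

end WindowDial

end Summit.QuantumAdvantage.QuantumAdvantage.Theorems.AnchorDial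

end
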